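import Mathlib
import Summits.AnomalousDissipation.AnomalousDissipation.Theorems.SolenoidalFractalHomogenisationLagrangianStepW7ThreeModeFibre
import HarnessLib

/-!
# K1L_D (stmt-AnomalousDissipation-27980), W7 ENGINE S1b — the slot step, part 1: cross-term algebra and the POINTWISE slot inequality
# (helper; `--supports stmt-AnomalousDissipation-27980 --as helper`)

Part 1 of the abstract slot step (part 2 = `…W7SlotStep.slot_step`).  One ramped slot, one slow Bloch chain `K₀, K_±, K_±±` with multiplicity `μ`;
coupling `l = c·A(t)`; dampings `y_j = modalAdjGen 𝔹 K_j w_j`: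
* `re_inner_bC`, `l_mul_Ydot_eq_xdotC` — algebra of the cross term `X = Re⟪w₀, bC l K₀ w₊ w₋⟫ = l·Y`, `Y = Re⟪w₀, P₀(w₊ − w₋)⟫`, and `l·Ẏ = xdotC`
  (the frozen-`l` derivative of the cross term is p4 g13's `xdotC`);
* **`pointwise_slot_ineq`** — pure real arithmetic at one instant: the three-mode form inequality (`ThreeMode.threeModeC3_form_le`, hypothesis `hform`)
  + the dissipation of the remainder of the energy at rate `dmin` (`hQ`) + Young on the ramp term `εcȦ·Y` (`|Y| ≤ ‖w₀‖(‖w₊‖+‖w₋‖)`, `Ȧ² ≤ 4/T²`)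
  + the drain floor `q‖w₀‖² ≤ Q̂(w₀)` give `−2Q + με·xdot + μεcȦ·Y ≤ −σ·E`, `σ = min(εc²(qA²/2 − 8ε/(dmin T²)), min(dmin, dtwo))`
  (both signs of the slow coefficient handled).
No definitions, no sorry.  W7 assembly owner: prover ad-sawtooth-k1loc-p1 g11 (memo `Lines/onelevel-W7-threemode.md` §2–§3 of p4 g13; spine of p5 g10).
NOT a proof of the crux / of AD; rung F-D1.A0. [cite: BedrossianCotiZelati2017, §2 (hypocoercivity functional with a cross term)] [problem: turb]
-/

set_option linter.dupNamespace false

namespace Summit.AnomalousDissipation.AnomalousDissipation.Theorems.SolenoidalFractalHomogenisation.LagrangianStep.W7Slot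

open Set Real MeasureTheory intervalIntegral
open scoped InnerProductSpace
open Literature.Analysis.FluidPDE Literature.Analysis.FluidPDE.Torus
open Literature.Analysis.FunctionSpaces.Torus (freqNormSq)
open Summit.AnomalousDissipation.AnomalousDissipation.Theorems.SolenoidalFractalHomogenisation.LagrangianStep.ThreeMode


/-! ## §1 Algebra of the cross term: `X = Re⟪w₀, bC l K₀ w₊ w₋⟫ = l · Re⟪w₀, P₀(w₊ − w₋)⟫` and `l·Ẏ = xdotC` -/

/-- `Re⟪w₀, bC l K₀ w₊ w₋⟫ = l · Re⟪w₀, P_{K₀}(w₊ − w₋)⟫`. [cite: BedrossianCotiZelati2017, §2] -/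
theorem re_inner_bC (l : ℝ) (K0 : Fin 3 → ℤ) (w0 wp wm : (EuclideanSpace ℂ (Fin 3))) :
    (⟪w0, bC l K0 wp wm⟫_ℂ).re = l * (⟪w0, transversalProj K0 (wp - wm)⟫_ℂ).re := by
  rw [bC, inner_smul_right, Complex.re_ofReal_mul]

/-- The frozen-`l` derivative of the cross term is `xdotC`: with `ẇ₀ = dW0C`, `ẇ₊ = dWpC`, `ẇ₋ = dWmC`,
`l·(Re⟪w₀, P₀(ẇ₊ − ẇ₋)⟫ + Re⟪ẇ₀, P₀(w₊ − w₋)⟫) = xdotC l …`. [cite: BedrossianCotiZelati2017, §2] -/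
theorem l_mul_Ydot_eq_xdotC (l : ℝ) (K0 Kp Km : Fin 3 → ℤ) (w0 wp wm wpp wmm y0 yp ym : (EuclideanSpace ℂ (Fin 3))) :
    l * ((⟪w0, transversalProj K0 (dWpC l Kp w0 wpp yp - dWmC l Km w0 wmm ym)⟫_ℂ).re
        + (⟪dW0C l K0 wp wm y0, transversalProj K0 (wp - wm)⟫_ℂ).re)
      = xdotC l K0 Kp Km w0 wp wm wpp wmm y0 yp ym := by
  rw [xdotC, bC, inner_smul_right, inner_smul_right, Complex.re_ofReal_mul, Complex.re_ofReal_mul]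
  ring

/-! ## §2 The pointwise (a.e.-in-time) inequality: form + remainder + ramp ⇒ `Φ̇ ≤ −σ·E` -/

/-- **Pointwise slot inequality.**  At one instant: the five chain modes with the three-mode form inequality already applied
(hypothesis `hform`, = `threeModeC3_form_le`), the dissipation split of the rest of the energy at rate `dmin`
(`hQ`), the ramp pairing `|Y| ≤ ‖w₀‖(‖w₊‖+‖w₋‖)`, the drain floor `q‖w₀‖² ≤ Q̂(w₀)` and `Ȧ² ≤ 4/T²` give
`−2Q + με·xdot + μεc·Ȧ·Y ≤ −σ·E`, `σ = min(εc²(qA²/2 − 8ε/(dmin T²)), min(dmin, dtwo))`. [cite: BedrossianCotiZelati2017, §2] -/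
theorem pointwise_slot_ineq {μ ε c q dmin dtwo d0 A Ad T x Qh Y Qt E S n0 np nm npp nmm : ℝ}
    (hμ : 0 < μ) (hε : 0 ≤ ε) (hc : 0 ≤ c) (hdmin : 0 < dmin) (hdtwo : 0 ≤ dtwo) (hd0 : 0 ≤ d0) (hT : 0 < T)
    (hform : -2 * S + ε * x ≤ -(ε * (c * A) ^ 2 / 2) * Qh - (5 * dmin / 4) * (np ^ 2 + nm ^ 2)
        - dtwo * (npp ^ 2 + nmm ^ 2) - (7 * d0 / 4) * n0 ^ 2)
    (hqh : q * n0 ^ 2 ≤ Qh)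
    (hY : |Y| ≤ n0 * (np + nm)) (hAd : Ad ^ 2 ≤ 4 / T ^ 2)
    (hE5 : μ * (n0 ^ 2 + np ^ 2 + nm ^ 2 + npp ^ 2 + nmm ^ 2) ≤ E)
    (hQ : μ * S + (dmin / 2) * (E - μ * (n0 ^ 2 + np ^ 2 + nm ^ 2 + npp ^ 2 + nmm ^ 2)) ≤ Qt) :
    -2 * Qt + μ * (ε * x) + μ * (ε * (c * Ad) * Y)
      ≤ -(min (ε * c ^ 2 * (q * A ^ 2 / 2 - 8 * ε / (dmin * T ^ 2))) (min dmin dtwo)) * E := by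
  set N5 := n0 ^ 2 + np ^ 2 + nm ^ 2 + npp ^ 2 + nmm ^ 2 with hN5
  set R := E - μ * N5 with hR
  set ρ₀ := ε * c ^ 2 * (q * A ^ 2 / 2 - 8 * ε / (dmin * T ^ 2)) with hρ₀
  set m := min ρ₀ (min dmin dtwo) with hm
  have hR0 : 0 ≤ R := by rw [hR]; linarith
  have hEeq : E = μ * N5 + R := by rw [hR]; ring
  -- (1) the dissipation split
  have h1 : -2 * Qt ≤ -2 * μ * S - dmin * R := by rw [hR]; linarith
  -- (2) the form inequality, times `μ`
  have h2 : μ * (-2 * S + ε * x) ≤ μ * (-(ε * (c * A) ^ 2 / 2) * Qh - (5 * dmin / 4) * (np ^ 2 + nm ^ 2)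
      - dtwo * (npp ^ 2 + nmm ^ 2) - (7 * d0 / 4) * n0 ^ 2) := mul_le_mul_of_nonneg_left hform hμ.le
  -- (3) the ramp term by Young against `dmin/4` of the `±1` dissipation
  have hεc : 0 ≤ ε * c := mul_nonneg hε hc
  have h3a : ε * (c * Ad) * Y ≤ ε * c * |Ad| * (n0 * (np + nm)) := by
    have : ε * (c * Ad) * Y ≤ |ε * (c * Ad) * Y| := le_abs_self _
    rw [abs_mul, abs_mul, abs_of_nonneg hε, abs_mul, abs_of_nonneg hc] at this
    calc ε * (c * Ad) * Y ≤ ε * (c * |Ad|) * |Y| := this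
      _ ≤ ε * (c * |Ad|) * (n0 * (np + nm)) := mul_le_mul_of_nonneg_left hY (by positivity)
      _ = ε * c * |Ad| * (n0 * (np + nm)) := by ring
  have hyoung : ∀ b : ℝ, ε * c * |Ad| * n0 * b ≤ (dmin / 4) * b ^ 2 + (ε ^ 2 * c ^ 2 * Ad ^ 2 / dmin) * n0 ^ 2 := by
    intro b
    have hsq : 0 ≤ (dmin / 2 * b - ε * c * |Ad| * n0) ^ 2 / dmin := div_nonneg (sq_nonneg _) hdmin.le
    have hexp : (dmin / 2 * b - ε * c * |Ad| * n0) ^ 2 / dmin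
        = (dmin / 4) * b ^ 2 - ε * c * |Ad| * n0 * b + (ε ^ 2 * c ^ 2 * |Ad| ^ 2 / dmin) * n0 ^ 2 := by
      field_simp
      ring
    rw [hexp, sq_abs] at hsq
    linarith
  have h3 : μ * (ε * (c * Ad) * Y) ≤ μ * ((dmin / 4) * (np ^ 2 + nm ^ 2) + (8 * ε ^ 2 * c ^ 2 / (dmin * T ^ 2)) * n0 ^ 2) := by
    refine mul_le_mul_of_nonneg_left ?_ hμ.le
    have hp' := hyoung np
    have hm' := hyoung nm
    have hAd' : (ε ^ 2 * c ^ 2 * Ad ^ 2 / dmin) * n0 ^ 2 ≤ (4 * ε ^ 2 * c ^ 2 / (dmin * T ^ 2)) * n0 ^ 2 := by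
      apply mul_le_mul_of_nonneg_right _ (sq_nonneg _)
      rw [div_le_div_iff₀ hdmin (by positivity)]
      have : ε ^ 2 * c ^ 2 * Ad ^ 2 * (dmin * T ^ 2) = (ε ^ 2 * c ^ 2 * dmin) * (Ad ^ 2 * T ^ 2) := by ring
      rw [this]
      have hAT : Ad ^ 2 * T ^ 2 ≤ 4 := by
        have := mul_le_mul_of_nonneg_right hAd (sq_nonneg T)
        rwa [div_mul_cancel₀ _ (by positivity)] at this
      have := mul_le_mul_of_nonneg_left hAT (by positivity : 0 ≤ ε ^ 2 * c ^ 2 * dmin)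
      linarith
    calc ε * (c * Ad) * Y ≤ ε * c * |Ad| * (n0 * (np + nm)) := h3a
      _ = ε * c * |Ad| * n0 * np + ε * c * |Ad| * n0 * nm := by ring
      _ ≤ (dmin / 4) * np ^ 2 + (ε ^ 2 * c ^ 2 * Ad ^ 2 / dmin) * n0 ^ 2
          + ((dmin / 4) * nm ^ 2 + (ε ^ 2 * c ^ 2 * Ad ^ 2 / dmin) * n0 ^ 2) := add_le_add hp' hm'
      _ ≤ (dmin / 4) * (np ^ 2 + nm ^ 2) + (8 * ε ^ 2 * c ^ 2 / (dmin * T ^ 2)) * n0 ^ 2 := by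
          have e8 : (8 * ε ^ 2 * c ^ 2 / (dmin * T ^ 2)) * n0 ^ 2 = 2 * ((4 * ε ^ 2 * c ^ 2 / (dmin * T ^ 2)) * n0 ^ 2) := by ring
          rw [e8]; linarith [hAd']
  -- (4) the drain floor and the slow coefficient
  have h4 : -(ε * (c * A) ^ 2 / 2) * Qh ≤ -(ε * c ^ 2 * q * A ^ 2 / 2) * n0 ^ 2 := by
    have hk : 0 ≤ ε * (c * A) ^ 2 / 2 := by positivity
    have h := mul_le_mul_of_nonneg_left hqh hk
    have e : ε * (c * A) ^ 2 / 2 * (q * n0 ^ 2) = (ε * c ^ 2 * q * A ^ 2 / 2) * n0 ^ 2 := by ring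
    rw [e] at h
    linarith
  -- the combined bound in terms of `ρ₀`
  have htot : -2 * Qt + μ * (ε * x) + μ * (ε * (c * Ad) * Y)
      ≤ -(μ * ρ₀ * n0 ^ 2) - μ * dmin * (np ^ 2 + nm ^ 2) - μ * dtwo * (npp ^ 2 + nmm ^ 2) - dmin * R := by
    have hd0n : 0 ≤ (7 * d0 / 4) * n0 ^ 2 := by positivity
    have e2 : μ * (-2 * S + ε * x) = -2 * μ * S + μ * (ε * x) := by ring
    have hρn : μ * ρ₀ * n0 ^ 2 = μ * ((ε * c ^ 2 * q * A ^ 2 / 2) * n0 ^ 2) - μ * ((8 * ε ^ 2 * c ^ 2 / (dmin * T ^ 2)) * n0 ^ 2) := by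
      rw [hρ₀]; ring
    have h4μ := mul_le_mul_of_nonneg_left h4 hμ.le
    have hd0μ := mul_nonneg hμ.le hd0n
    have e2' : μ * (-(ε * (c * A) ^ 2 / 2) * Qh - (5 * dmin / 4) * (np ^ 2 + nm ^ 2) - dtwo * (npp ^ 2 + nmm ^ 2) - (7 * d0 / 4) * n0 ^ 2)
        = μ * (-(ε * (c * A) ^ 2 / 2) * Qh) - μ * (5 * dmin / 4) * (np ^ 2 + nm ^ 2) - μ * dtwo * (npp ^ 2 + nmm ^ 2)
          - μ * ((7 * d0 / 4) * n0 ^ 2) := by ring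
    have e3' : μ * ((dmin / 4) * (np ^ 2 + nm ^ 2) + (8 * ε ^ 2 * c ^ 2 / (dmin * T ^ 2)) * n0 ^ 2)
        = μ * (dmin / 4) * (np ^ 2 + nm ^ 2) + μ * ((8 * ε ^ 2 * c ^ 2 / (dmin * T ^ 2)) * n0 ^ 2) := by ring
    rw [e2] at h2
    rw [e2'] at h2
    rw [e3'] at h3
    rw [hρn]
    linarith [h1, h2, h3, h4μ, hd0μ]
  -- (5) case analysis on the sign of the slow coefficient
  have hmρ : m ≤ ρ₀ := min_le_left _ _
  have hmd : m ≤ dmin := (min_le_right _ _).trans (min_le_left _ _)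
  have hmt : m ≤ dtwo := (min_le_right _ _).trans (min_le_right _ _)
  have hsum0 : 0 ≤ np ^ 2 + nm ^ 2 := by positivity
  have hsum2 : 0 ≤ npp ^ 2 + nmm ^ 2 := by positivity
  rcases le_or_gt 0 ρ₀ with hρ | hρ
  · -- `ρ₀ ≥ 0`: every coefficient is at least `m ≥ 0`
    have hm0 : 0 ≤ m := le_min hρ (le_min hdmin.le hdtwo)
    have : -(μ * ρ₀ * n0 ^ 2) - μ * dmin * (np ^ 2 + nm ^ 2) - μ * dtwo * (npp ^ 2 + nmm ^ 2) - dmin * R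
        ≤ -m * E := by
      rw [hEeq, hN5]
      have p1 := mul_le_mul_of_nonneg_right hmρ (by positivity : 0 ≤ μ * n0 ^ 2)
      have p2 := mul_le_mul_of_nonneg_right hmd (by positivity : 0 ≤ μ * (np ^ 2 + nm ^ 2))
      have p3 := mul_le_mul_of_nonneg_right hmt (by positivity : 0 ≤ μ * (npp ^ 2 + nmm ^ 2))
      have p4 := mul_le_mul_of_nonneg_right hmd hR0
      have e : -m * (μ * (n0 ^ 2 + np ^ 2 + nm ^ 2 + npp ^ 2 + nmm ^ 2) + R)
          = -(m * (μ * n0 ^ 2)) - m * (μ * (np ^ 2 + nm ^ 2)) - m * (μ * (npp ^ 2 + nmm ^ 2)) - m * R := by ring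
      have e' : -(μ * ρ₀ * n0 ^ 2) - μ * dmin * (np ^ 2 + nm ^ 2) - μ * dtwo * (npp ^ 2 + nmm ^ 2) - dmin * R
          = -(ρ₀ * (μ * n0 ^ 2)) - dmin * (μ * (np ^ 2 + nm ^ 2)) - dtwo * (μ * (npp ^ 2 + nmm ^ 2)) - dmin * R := by ring
      rw [e, e']
      linarith
    exact htot.trans this
  · -- `ρ₀ < 0`: `m = ρ₀` and `−ρ₀ μ‖w₀‖² ≤ −ρ₀ E`
    have hmin : m = ρ₀ := by
      rw [hm]; exact min_eq_left (le_min (hρ.le.trans hdmin.le) (hρ.le.trans hdtwo))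
    have hn0E : μ * n0 ^ 2 ≤ E := by
      rw [hEeq, hN5]
      have p2 := mul_nonneg hμ.le hsum0
      have p3 := mul_nonneg hμ.le hsum2
      have e : μ * (n0 ^ 2 + np ^ 2 + nm ^ 2 + npp ^ 2 + nmm ^ 2) = μ * n0 ^ 2 + μ * (np ^ 2 + nm ^ 2) + μ * (npp ^ 2 + nmm ^ 2) := by ring
      rw [e]; linarith
    have : -(μ * ρ₀ * n0 ^ 2) - μ * dmin * (np ^ 2 + nm ^ 2) - μ * dtwo * (npp ^ 2 + nmm ^ 2) - dmin * R
        ≤ -m * E := by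
      rw [hmin]
      have p1 := mul_le_mul_of_nonneg_left hn0E (neg_nonneg.2 hρ.le)
      have p2 := mul_nonneg (mul_nonneg hμ.le hdmin.le) hsum0
      have p3 := mul_nonneg (mul_nonneg hμ.le hdtwo) hsum2
      have p4 := mul_nonneg hdmin.le hR0
      have e' : -(μ * ρ₀ * n0 ^ 2) = -ρ₀ * (μ * n0 ^ 2) := by ring
      rw [e']
      linarith
    exact htot.trans this

end Summit.AnomalousDissipation.AnomalousDissipation.Theorems.SolenoidalFractalHomogenisation.LagrangianStep.W7Slot
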